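import Mathlib.GroupTheory.Sylow
import Mathlib.GroupTheory.PGroup
import Mathlib.GroupTheory.Perm.Cycle.Type
import Mathlib.GroupTheory.SemidirectProduct
import Mathlib.Data.Nat.Factorization.Basic
import Mathlib.Data.Int.GCD
import Mathlib.Data.ZMod.Basic
import Mathlib.Topology.Algebra.ClopenNhdofOne
import Mathlib.Topology.Algebra.OpenSubgroup
import Literature.AnabelianGeometry.AbsoluteAnabelian.FreeProSigmaOpenSubgroups
import Summits.ABC.IUTFork.FreeProfiniteUniqueRootsNoGo
import HarnessLib

/-!
# Free pro-`Σ` groups of rank `≥ 2` have NO unique roots once `Σ` contains TWO primes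

Cell `abc-iut` (run/shared/lean/pub/abc-iut/), layer L4 — sequel to
`FreeProfiniteUniqueRootsNoGo.lean` (abc-iut-L4-t12, row «R5-KERNEL / UNIQUE-ROOTS-FAIL»; finding
T1g11-F1 of abc-iut-L5-t1): there a profinite group with an `S₃`-quotient — e.g. a free pro-`Σ`
group of rank `≥ 2` with `2, 3 ∈ Σ` — is shown not `IsMulTorsionFree` (Mathlib: "`x ↦ xⁿ`
injective", i.e. UNIQUE ROOTS), an arbitrary pair of primes being left as `TODO(general form)`.
This PROOF-ONLY file (no definitions, no named facts) settles it, with NO congruence condition: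
* `exists_comm_pow_of_finite` — FINITE LEVEL: `φ : A → K` from a finite group, `V ⊴ K` a normal
  COMMUTATIVE `q`-subgroup, `p ≠ q` primes, `a, b ∈ A` with `φ b ∈ V`, `(φ a)ᵖ ∈ V`,
  `φ a φ b ≠ φ b φ a` ⇒ some `g, h ∈ A` have `h gᵖ = gᵖ h`, `φ [h, g] ≠ 1` (the `q`-part of `b`
  lies in a Sylow `q`-subgroup `Q` of `M := φ⁻¹V ⊴ A`; Frattini `A = N_A(Q)·M` moves `a` to a
  normalising lift, then to its `p`-part `g` — non-commutation with `φ b` survives both coprime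
  powers by Bézout —; conjugation by `gᵖ`, central on `φ(Q) ⊆ V`, permutes the coset
  `{h ∈ Q | φ h = φ b}` of `q`-power size and has a fixed point `h`);
* `exists_comm_pow_ne`, **`not_isMulTorsionFree_of_comm_pow`** — PROFINITE LEVEL: the same data
  for a compact Hausdorff totally disconnected `A` and `φ` with open kernel give `h gᵖ = gᵖ h`,
  `h g h⁻¹ ≠ g`, so `(h g h⁻¹)ᵖ = gᵖ`: NOT `IsMulTorsionFree` (compactness, as in the `S₃` file);
* **`not_isMulTorsionFree_of_isFreeProOn_of_prime_ne`** — a free pro-`Σ` group of rank `n ≥ 2`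
  ([AbsTopI] Lem. 4.5 (i) vocabulary `IsFreeProOn`) with two distinct primes `p, q ∈ Σ` is NOT
  `IsMulTorsionFree`; the witness `Σ`-group is the regular wreath product `(ℤ/p → ℤ/q) ⋊ ℤ/p`
  (`|K| = qᵖ·p`), `V` = the base group, `κ` = the shift, `v = δ₀`: `κ v κ⁻¹ ≠ v` — as the finite
  level does not ask `φ` to be surjective, neither a fixed-point-free action nor `p ∣ q − 1` is
  needed; `not_isMulTorsionFree_of_isOpen_of_isFreeProOn` — the same for every OPEN subgroup
  (Schreier: open subgroups are free pro-`Σ` of rank `≥ 2`, `FreeProSigmaOpenSubgroups.lean`);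
  `not_isMulTorsionFree_of_isFreeProOn_proOmissive` — every PRO-OMISSIVE `Σ = Primes ∖ {ℓ}`
  ([AbsTopI] Def. 1.1 (iii)), incl. `ℓ ∈ {2, 3}` where the `S₃` argument is silent;
  `not_mem_semiEllipticDoubleCoverSubgroups_of_isFreeProOn_of_prime_ne` — the [AbsTopII]
  Cor. 3.3 (ii) typed right-hand side (F-0234) excludes every `J` with `J ∩ Δ_C` free pro-`Σ` of
  rank `≥ 2` whenever `Σ` holds two primes.
READING (numbers, not adjectives): for `Σ ⊇ {p, q}`, `p ≠ q`, every binder `IsMulTorsionFree ↥Δ`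
at a free pro-`Σ` `Δ` of rank `≥ 2`, or at an open subgroup of one, is FALSE; for `Σ = {ℓ}` (free
pro-`ℓ`, where unique roots do hold) this file says nothing.  HONEST FRAMING: classical
(pro)finite group theory, elementary; refuted-as-TYPED at OUR predicate, not a statement about
print; nothing here bears on [IUTchIII] Cor. 3.12; typed ≠ proved elsewhere.
-/

noncomputable section
noncomputable section

namespace Summit.ABC.IUTFork

open Topology Literature.AnabelianGeometry.AbsoluteAnabelian

universe u

/-- Bézout for subgroup membership: `xᵐ ∈ H`, `xⁿ ∈ H`, `gcd(m, n) = 1` ⇒ `x ∈ H`. [folklore] -/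
private theorem mem_of_pow_mem_of_coprime {K : Type*} [Group K] (H : Subgroup K) {x : K} {m n : ℕ}
    (hmn : m.Coprime n) (hm : x ^ m ∈ H) (hn : x ^ n ∈ H) : x ∈ H := by
  have h1 : ((m.gcd n : ℕ) : ℤ) = (m : ℤ) * Nat.gcdA m n + (n : ℤ) * Nat.gcdB m n :=
    Nat.gcd_eq_gcd_ab m n
  rw [hmn.gcd_eq_one, Nat.cast_one] at h1
  have hx : x = (x ^ m) ^ Nat.gcdA m n * (x ^ n) ^ Nat.gcdB m n := by
    rw [← zpow_natCast x m, ← zpow_natCast x n, ← zpow_mul, ← zpow_mul, ← zpow_add, ← h1, zpow_one]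
  rw [hx]; exact H.mul_mem (H.zpow_mem hm _) (H.zpow_mem hn _)

/-- If `xᵐ` and `xⁿ` commute with `y` and `gcd(m, n) = 1`, then `x` commutes with `y`. [folklore] -/
private theorem comm_of_pow_comm_of_coprime {K : Type*} [Group K] {x y : K} {m n : ℕ}
    (hmn : m.Coprime n) (hm : x ^ m * y = y * x ^ m) (hn : x ^ n * y = y * x ^ n) :
    x * y = y * x := by
  have key : ∀ {k : ℕ}, x ^ k * y = y * x ^ k → x ^ k ∈ Subgroup.centralizer ({y} : Set K) :=
    fun hk => Subgroup.mem_centralizer_iff.mpr fun z hz => by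
      rw [Set.mem_singleton_iff.mp hz]; exact hk.symm
  exact (Subgroup.mem_centralizer_iff.mp
    (mem_of_pow_mem_of_coprime _ hmn (key hm) (key hn)) y rfl).symm

/-- **Finite level.**  `φ : A → K` from a finite group, `V ⊴ K` a normal commutative
`q`-subgroup, `p ≠ q` primes, `a, b ∈ A` with `φ b ∈ V`, `(φ a)ᵖ ∈ V`, `φ a φ b ≠ φ b φ a`: then
some `g, h ∈ A` satisfy `h gᵖ = gᵖ h` and `φ (h g h⁻¹ g⁻¹) ≠ 1` (Sylow `q`-subgroup of `φ⁻¹V`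
through the `q`-part of `b`; Frattini; `p`-part of the normalising lift of `a`; fixed point of
conjugation by `gᵖ` on the coset `{h ∈ Q | φ h = φ b}`). [folklore] -/
theorem exists_comm_pow_of_finite {A K : Type*} [Group A] [Finite A] [Group K] (φ : A →* K)
    (V : Subgroup K) [V.Normal] (hVc : ∀ x ∈ V, ∀ y ∈ V, x * y = y * x)
    {p q : ℕ} (hp : p.Prime) (hq : q.Prime) (hpq : p ≠ q) (hV : IsPGroup q V)
    {a b : A} (hb : φ b ∈ V) (ha : φ a ^ p ∈ V) (hab : φ a * φ b ≠ φ b * φ a) :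
    ∃ g h : A, h * g ^ p = g ^ p * h ∧ φ (h * g * h⁻¹ * g⁻¹) ≠ 1 := by
  classical
  haveI : Fact p.Prime := ⟨hp⟩
  haveI : Fact q.Prime := ⟨hq⟩
  -- (1) the `q`-part `b₁` of `b`
  obtain ⟨e, r, hqr, hordb⟩ :=
    Nat.exists_eq_pow_mul_and_not_dvd (orderOf_pos b).ne' q hq.one_lt.ne'
  set b₁ : A := b ^ r with hb₁_def
  have hb₁q : b₁ ^ q ^ e = 1 := by rw [hb₁_def, ← pow_mul, mul_comm, ← hordb, pow_orderOf_eq_one]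
  have hφb₁ : φ b₁ ∈ V := by rw [hb₁_def, map_pow]; exact V.pow_mem hb r
  have hab₁ : φ a * φ b₁ ≠ φ b₁ * φ a := by
    refine fun hcomm => hab ?_
    obtain ⟨i, hi⟩ := hV ⟨φ b, hb⟩
    have hbi : φ b ^ q ^ i = 1 := by simpa using congrArg Subtype.val hi
    exact (comm_of_pow_comm_of_coprime (((hq.coprime_iff_not_dvd).mpr hqr).pow_left i)
      (by rw [hbi, one_mul, mul_one]) (by rw [← map_pow, ← hb₁_def]; exact hcomm.symm)).symm
  -- (2) a Sylow `q`-subgroup `Q` of `M := φ⁻¹ V` through `b₁`; Frattini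
  let M : Subgroup A := V.comap φ
  haveI hMn : M.Normal := Subgroup.Normal.comap inferInstance φ
  let bM : M := ⟨b₁, hφb₁⟩
  have hbMq : bM ^ q ^ e = 1 := Subtype.ext (by simp [bM, hb₁q])
  have hzp : IsPGroup q (Subgroup.zpowers bM) := by
    rintro ⟨x, hx⟩
    obtain ⟨i, rfl⟩ := Subgroup.mem_zpowers_iff.mp hx
    refine ⟨e, Subtype.ext ?_⟩
    simp only [SubmonoidClass.mk_pow, OneMemClass.coe_one]
    rw [← zpow_natCast, ← zpow_mul, mul_comm, zpow_mul, zpow_natCast, hbMq, one_zpow]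
  obtain ⟨P, hP⟩ := hzp.exists_le_sylow
  let Q : Subgroup A := (P : Subgroup M).map M.subtype
  have hb₁Q : b₁ ∈ Q := ⟨bM, hP (Subgroup.mem_zpowers bM), rfl⟩
  have hQq : IsPGroup q Q := P.isPGroup'.map M.subtype
  have hfrat : Subgroup.normalizer (Q : Set A) ⊔ M = ⊤ := Sylow.normalizer_sup_eq_top P
  obtain ⟨n, hn, m, hm, hnm⟩ :=
    (Subgroup.mem_sup_of_normal_right (s := Subgroup.normalizer (Q : Set A)) (t := M)).mp
      (hfrat.symm ▸ Subgroup.mem_top a)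
  have hφm : φ m ∈ V := hm
  have hφn : φ n = φ a * (φ m)⁻¹ := by rw [← hnm, map_mul, mul_inv_cancel_right]
  have hφnp : φ n ^ p ∈ V := by
    have hmk : (QuotientGroup.mk (φ n) : K ⧸ V) = QuotientGroup.mk (φ a) := by
      rw [hφn, QuotientGroup.mk_mul, QuotientGroup.mk_inv, (QuotientGroup.eq_one_iff _).mpr hφm,
        inv_one, mul_one]
    rw [← QuotientGroup.eq_one_iff, QuotientGroup.mk_pow, hmk, ← QuotientGroup.mk_pow,
      QuotientGroup.eq_one_iff]; exact ha
  have hnb₁ : φ n * φ b₁ ≠ φ b₁ * φ n := hφn ▸ fun h => hab₁ <| by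
    have hc : (φ m)⁻¹ * φ b₁ = φ b₁ * (φ m)⁻¹ := hVc _ (V.inv_mem hφm) _ hφb₁
    calc φ a * φ b₁ = φ a * (φ m)⁻¹ * φ b₁ * φ m := by
          rw [mul_assoc (φ a) ((φ m)⁻¹) (φ b₁), hc, ← mul_assoc (φ a), inv_mul_cancel_right]
      _ = φ b₁ * (φ a * (φ m)⁻¹) * φ m := by rw [h]
      _ = φ b₁ * φ a := by rw [mul_assoc, inv_mul_cancel_right]
  -- (3) the `p`-part `g` of the normalising lift `n`
  obtain ⟨e₂, m', hpm', hordn⟩ :=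
    Nat.exists_eq_pow_mul_and_not_dvd (orderOf_pos n).ne' p hp.one_lt.ne'
  set g : A := n ^ m' with hg_def
  have hgnorm : g ∈ Subgroup.normalizer (Q : Set A) := Subgroup.pow_mem _ hn m'
  have hgp : g ^ p ^ e₂ = 1 := by rw [hg_def, ← pow_mul, mul_comm, ← hordn, pow_orderOf_eq_one]
  have hφg : φ g = φ n ^ m' := by rw [hg_def, map_pow]
  have hφgpV : φ g ^ p ∈ V := by rw [hφg, ← pow_mul, mul_comm, pow_mul]; exact V.pow_mem hφnp m'
  have hgb₁ : φ g * φ b₁ ≠ φ b₁ * φ g := fun hcomm => hnb₁ <| comm_of_pow_comm_of_coprime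
    ((hp.coprime_iff_not_dvd).mpr hpm') (hVc _ hφnp _ hφb₁) (hφg ▸ hcomm)
  -- (4) conjugation by `y := gᵖ` on the coset `S := {h ∈ Q | φ h = φ b₁}` has a fixed point
  set y : A := g ^ p with hy_def
  have hynorm : y ∈ Subgroup.normalizer (Q : Set A) := Subgroup.pow_mem _ hgnorm p
  have hyp : y ^ p ^ e₂ = 1 := by rw [hy_def, ← pow_mul, mul_comm, pow_mul, hgp, one_pow]
  have hφy : Commute (φ y) (φ b₁) := by rw [hy_def, map_pow]; exact hVc _ hφgpV _ hφb₁
  have hyn := Subgroup.mem_normalizer_iff.mp hynorm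
  have hyn' := Subgroup.mem_normalizer_iff''.mp hynorm
  let S : Set A := {h | h ∈ Q ∧ φ h = φ b₁}
  haveI : Fintype S := Fintype.ofFinite S
  let eS : S ≃ ↥(Q ⊓ φ.ker) :=
    { toFun := fun h => ⟨b₁⁻¹ * h, Subgroup.mem_inf.mpr
        ⟨Q.mul_mem (Q.inv_mem hb₁Q) h.2.1,
          by rw [MonoidHom.mem_ker, map_mul, map_inv, h.2.2, inv_mul_cancel]⟩⟩
      invFun := fun k => ⟨b₁ * k, ⟨Q.mul_mem hb₁Q (Subgroup.mem_inf.mp k.2).1,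
          by rw [map_mul, (MonoidHom.mem_ker).mp (Subgroup.mem_inf.mp k.2).2, mul_one]⟩⟩
      left_inv := fun h => by ext; simp
      right_inv := fun k => by ext; simp }
  have hcardS : ¬ p ∣ Fintype.card S := by
    rw [← Nat.card_eq_fintype_card, Nat.card_congr eS]
    obtain ⟨j, hj⟩ := IsPGroup.iff_card.mp (hQq.to_le inf_le_left : IsPGroup q ↥(Q ⊓ φ.ker))
    exact hj ▸ fun hdvd => hpq ((Nat.prime_dvd_prime_iff_eq hp hq).mp (hp.dvd_of_dvd_pow hdvd))
  have hmemS : ∀ h : A, h ∈ S → y * h * y⁻¹ ∈ S := fun h hh =>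
    ⟨(hyn h).mp hh.1, by rw [map_mul, map_mul, map_inv, hh.2, hφy.eq, mul_inv_cancel_right]⟩
  have hmemS' : ∀ h : A, h ∈ S → y⁻¹ * h * y ∈ S := fun h hh => ⟨(hyn' h).mp hh.1, by
    rw [map_mul, map_mul, map_inv, hh.2, hφy.inv_left.eq, inv_mul_cancel_right]⟩
  let τS : Equiv.Perm S :=
    { toFun := fun h => ⟨y * h * y⁻¹, hmemS h.1 h.2⟩
      invFun := fun h => ⟨y⁻¹ * h * y, hmemS' h.1 h.2⟩
      left_inv := fun h => by ext; simp [mul_assoc]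
      right_inv := fun h => by ext; simp [mul_assoc] }
  have hτS_iter : ∀ (k : ℕ) (h : S), ((τS ^ k) h : A) = y ^ k * h * (y ^ k)⁻¹ := fun k => by
    induction k with
    | zero => intro h; simp
    | succ k ih =>
      intro h
      rw [pow_succ', Equiv.Perm.mul_apply, show ((τS ((τS ^ k) h) : S) : A) = y * _ * y⁻¹ from rfl,
        ih, pow_succ', mul_inv_rev]
      simp only [mul_assoc]
  have hτS : τS ^ p ^ e₂ = 1 := Equiv.ext fun h => Subtype.ext (by
    rw [hτS_iter, hyp, Equiv.Perm.coe_one, id_eq, one_mul, inv_one, mul_one])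
  obtain ⟨U, hU⟩ := Equiv.Perm.exists_fixed_point_of_prime hcardS hτS
  have hyU : y * U * y⁻¹ = U := congrArg Subtype.val hU
  refine ⟨g, U, hy_def ▸ (mul_inv_eq_iff_eq_mul.mp hyU).symm, fun h1 => hgb₁ ?_⟩
  rw [map_mul, map_mul, map_mul, map_inv, map_inv, U.2.2] at h1
  exact (mul_inv_eq_iff_eq_mul.mp (mul_inv_eq_one.mp h1)).symm

/-- **Profinite level.**  In a compact Hausdorff totally disconnected topological group `A` with
`φ : A → K` of open kernel, `V ⊴ K` normal commutative `q`-group, `p ≠ q` primes, `a, b ∈ A` with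
`φ b ∈ V`, `(φ a)ᵖ ∈ V`, `φ a φ b ≠ φ b φ a`, there are `g, h` with `h gᵖ = gᵖ h` and `h g h⁻¹ ≠ g`
(for `N ⊴ A` open normal the closed set `C_N = {(g, h) : h gᵖ h⁻¹ g⁻ᵖ ∈ N, [h, g] ∉ Ker φ}` is
nonempty by the finite level in `A / (N ∩ Ker φ)`, `N ↦ C_N` is directed, `⋂_N C_N ≠ ∅` and
`⋂_N N = 1`). [folklore] -/
theorem exists_comm_pow_ne {A : Type*} [Group A] [TopologicalSpace A] [IsTopologicalGroup A]
    [CompactSpace A] [T2Space A] [TotallyDisconnectedSpace A] {K : Type*} [Group K] (φ : A →* K)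
    (hker : IsOpen (φ.ker : Set A)) (V : Subgroup K) [V.Normal]
    (hVc : ∀ x ∈ V, ∀ y ∈ V, x * y = y * x) {p q : ℕ} (hp : p.Prime) (hq : q.Prime) (hpq : p ≠ q)
    (hV : IsPGroup q V) {a b : A} (hb : φ b ∈ V) (ha : φ a ^ p ∈ V)
    (hab : φ a * φ b ≠ φ b * φ a) :
    ∃ g h : A, h * g ^ p = g ^ p * h ∧ h * g * h⁻¹ ≠ g := by
  classical
  let c₁ : A × A → A := fun z => z.2 * z.1 ^ p * z.2⁻¹ * (z.1 ^ p)⁻¹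
  let c₂ : A × A → A := fun z => z.2 * z.1 * z.2⁻¹ * z.1⁻¹
  have hc₁ : Continuous c₁ := by fun_prop
  have hc₂ : Continuous c₂ := by fun_prop
  let N₀ : OpenNormalSubgroup A := ⟨⟨φ.ker, hker⟩, inferInstance⟩
  let C : OpenNormalSubgroup A → Set (A × A) := fun N =>
    c₁ ⁻¹' (N : Set A) ∩ (c₂ ⁻¹' (φ.ker : Set A))ᶜ
  have hCclosed : ∀ N, IsClosed (C N) := fun N =>
    (N.toOpenSubgroup.isClosed.preimage hc₁).inter (hker.preimage hc₂).isClosed_compl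
  have hCne : ∀ N, (C N).Nonempty := by
    intro N
    let L : OpenNormalSubgroup A := N ⊓ N₀
    have hLK : (L : Subgroup A) ≤ φ.ker := fun x hx => (inf_le_right : N ⊓ N₀ ≤ N₀) hx
    have hLN : (L : Subgroup A) ≤ (N : Subgroup A) := fun x hx => (inf_le_left : N ⊓ N₀ ≤ N) hx
    haveI : Finite (A ⧸ (L : Subgroup A)) := Subgroup.quotient_finite_of_isOpen _ L.isOpen'
    let φq : A ⧸ (L : Subgroup A) →* K := QuotientGroup.lift _ φ hLK
    have hφq : ∀ x : A, φq (QuotientGroup.mk x) = φ x := fun x => by simp [φq]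
    obtain ⟨gb, hb', hcomm, hne⟩ := exists_comm_pow_of_finite φq V hVc hp hq hpq hV
      (a := QuotientGroup.mk a) (b := QuotientGroup.mk b)
      (by rw [hφq]; exact hb) (by rw [hφq]; exact ha) (by rw [hφq, hφq]; exact hab)
    obtain ⟨g, rfl⟩ := QuotientGroup.mk_surjective gb
    obtain ⟨h, rfl⟩ := QuotientGroup.mk_surjective hb'
    refine ⟨(g, h), ?_, ?_⟩
    · show c₁ (g, h) ∈ (N : Set A)
      apply hLN
      rw [← QuotientGroup.eq_one_iff]
      simp only [c₁, QuotientGroup.mk_mul, QuotientGroup.mk_inv, QuotientGroup.mk_pow]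
      rw [hcomm, mul_inv_cancel_right, mul_inv_cancel]
    · show (g, h) ∉ c₂ ⁻¹' (φ.ker : Set A)
      refine fun hmem => hne ?_
      have h' : φ (h * g * h⁻¹ * g⁻¹) = 1 := hmem
      simpa [φq] using h'
  have hCdir : Directed (· ⊇ ·) C := fun N₁ N₂ => ⟨N₁ ⊓ N₂,
    fun z hz => ⟨(inf_le_left : N₁ ⊓ N₂ ≤ N₁) hz.1, hz.2⟩,
    fun z hz => ⟨(inf_le_right : N₁ ⊓ N₂ ≤ N₂) hz.1, hz.2⟩⟩
  haveI : Nonempty (OpenNormalSubgroup A) := ⟨N₀⟩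
  obtain ⟨⟨g, h⟩, hz⟩ := IsCompact.nonempty_iInter_of_directed_nonempty_isCompact_isClosed C hCdir
    hCne (fun N => (hCclosed N).isCompact) hCclosed
  have hz' : ∀ N, (g, h) ∈ C N := fun N => Set.mem_iInter.mp hz N
  refine ⟨g, h, ?_, fun heq => ?_⟩
  · have h1 : c₁ (g, h) = 1 := by_contra fun hw => by
      obtain ⟨N, hN⟩ := ProfiniteGrp.exist_openNormalSubgroup_sub_open_nhds_of_one
        (isOpen_compl_singleton (x := c₁ (g, h))) (by simpa using (Ne.symm hw))
      exact hN (hz' N).1 rfl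
    exact mul_inv_eq_iff_eq_mul.mp (mul_inv_eq_one.mp (h1 : h * g ^ p * h⁻¹ * (g ^ p)⁻¹ = 1))
  · apply (hz' N₀).2
    show φ (h * g * h⁻¹ * g⁻¹) = 1
    rw [heq, mul_inv_cancel, map_one]

/-- **A profinite group mapping to a group with a normal commutative `q`-subgroup `V` such that
some `p`-torsion-mod-`V` image fails to commute with some image in `V` does NOT have unique `p`-th
roots**: `(h g h⁻¹)ᵖ = h gᵖ h⁻¹ = gᵖ` but `h g h⁻¹ ≠ g`; it is not `IsMulTorsionFree`. [folklore] -/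
theorem not_isMulTorsionFree_of_comm_pow {A : Type*} [Group A] [TopologicalSpace A]
    [IsTopologicalGroup A] [CompactSpace A] [T2Space A] [TotallyDisconnectedSpace A]
    {K : Type*} [Group K] (φ : A →* K) (hker : IsOpen (φ.ker : Set A)) (V : Subgroup K)
    [V.Normal] (hVc : ∀ x ∈ V, ∀ y ∈ V, x * y = y * x) {p q : ℕ} (hp : p.Prime) (hq : q.Prime)
    (hpq : p ≠ q) (hV : IsPGroup q V) {a b : A} (hb : φ b ∈ V) (ha : φ a ^ p ∈ V)
    (hab : φ a * φ b ≠ φ b * φ a) : ¬ IsMulTorsionFree A := by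
  intro htf
  obtain ⟨g, h, hcomm, hne⟩ := exists_comm_pow_ne φ hker V hVc hp hq hpq hV hb ha hab
  have hpow : (h * g * h⁻¹) ^ p = g ^ p := by rw [conj_pow, hcomm, mul_inv_cancel_right]
  exact hne (IsMulTorsionFree.pow_left_injective hp.ne_zero hpow)

section FreePro

variable {G : Type u} [Group G] [TopologicalSpace G]
variable {S : Set ℕ} {n : ℕ} {gens : Fin n → G}
variable [IsTopologicalGroup G] [CompactSpace G] [T2Space G] [TotallyDisconnectedSpace G]

/-- **Free pro-`Σ` groups of rank `≥ 2` with two distinct primes `p, q ∈ Σ` do NOT have unique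
roots**: `IsFreeProOn G Σ gens`, `2 ≤ n`, `p ≠ q` primes in `Σ` ⇒ `¬ IsMulTorsionFree G`
(although `G` IS torsion-free, `IsFreeProOn.torsionFree`).  The generators are sent into the
regular wreath product `(ℤ/p → ℤ/q) ⋊ ℤ/p`, a finite `{p, q}`-group (`0 ↦` the shift `κ`, `1 ↦ δ₀`
in the base group, the others `↦ 1`; [AbsTopI] Lem. 4.5 (i) universal property), where
`κ δ₀ κ⁻¹ ≠ δ₀`. [cite: MochizukiAbsTopI2012, Lemma 4.5 (i) p.54] -/
theorem not_isMulTorsionFree_of_isFreeProOn_of_prime_ne (h : IsFreeProOn G S gens) (hn : 2 ≤ n)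
    {p q : ℕ} (hp : p.Prime) (hq : q.Prime) (hpq : p ≠ q) (hpS : p ∈ S) (hqS : q ∈ S) :
    ¬ IsMulTorsionFree G := by
  classical
  haveI : Fact p.Prime := ⟨hp⟩
  haveI : Fact q.Prime := ⟨hq⟩
  -- the regular wreath product `(ℤ/p → ℤ/q) ⋊ ℤ/p`
  let N : Type := ZMod p → Multiplicative (ZMod q)
  let C : Type := Multiplicative (ZMod p)
  let sh : C → MulAut N := fun t =>
    { toFun := fun f i => f (i + t.toAdd)
      invFun := fun f i => f (i - t.toAdd)
      left_inv := fun f => funext fun i => by simp only [sub_add_cancel]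
      right_inv := fun f => funext fun i => by simp only [add_sub_cancel_right]
      map_mul' := fun _ _ => rfl }
  let τ : C →* MulAut N := MonoidHom.mk' sh fun s t => MulEquiv.ext fun f => funext fun i =>
    show f (i + (s * t).toAdd) = f (i + s.toAdd + t.toAdd) by rw [toAdd_mul, add_assoc]
  have hτ : ∀ (t : C) (f : N) (i : ZMod p), τ t f i = f (i + t.toAdd) := fun _ _ _ => rfl
  letI : TopologicalSpace (N ⋊[τ] C) := ⊥
  haveI : DiscreteTopology (N ⋊[τ] C) := ⟨rfl⟩
  haveI : Finite (N ⋊[τ] C) := Finite.of_equiv _ SemidirectProduct.equivProd.symm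
  have hcardN : Nat.card N = q ^ p := by
    rw [Nat.card_fun, Nat.card_congr Multiplicative.toAdd, Nat.card_zmod, Nat.card_zmod]
  have hK : ∀ r : ℕ, r.Prime → r ∣ Nat.card (N ⋊[τ] C) → r ∈ S := by
    intro r hr hdvd
    rw [SemidirectProduct.card, hcardN, Nat.card_congr Multiplicative.toAdd, Nat.card_zmod] at hdvd
    rcases (Nat.Prime.dvd_mul hr).mp hdvd with h' | h'
    · rwa [(Nat.prime_dvd_prime_iff_eq hr hq).mp (hr.dvd_of_dvd_pow h')]
    · rwa [(Nat.prime_dvd_prime_iff_eq hr hp).mp h']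
  let κ : C := Multiplicative.ofAdd 1
  let δ : N := Pi.mulSingle 0 (Multiplicative.ofAdd 1)
  let f : Fin n → N ⋊[τ] C := fun i => if (i : ℕ) = 0 then SemidirectProduct.inr κ else
    if (i : ℕ) = 1 then SemidirectProduct.inl δ else 1
  obtain ⟨ψ, ⟨hψc, hψf⟩, -⟩ := h.2 (N ⋊[τ] C) hK f
  have h0 : ψ (gens ⟨0, by omega⟩) = SemidirectProduct.inr κ := by rw [hψf]; simp [f]
  have h1 : ψ (gens ⟨1, by omega⟩) = SemidirectProduct.inl δ := by rw [hψf]; simp [f]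
  have hψker : IsOpen (ψ.ker : Set G) := by
    rw [show (ψ.ker : Set G) = ψ ⁻¹' {1} by ext x; simp]
    exact (isOpen_discrete _).preimage hψc
  -- the base group `V`
  let V : Subgroup (N ⋊[τ] C) := (SemidirectProduct.inl : N →* N ⋊[τ] C).range
  haveI : V.Normal := by
    rw [show V = _ from SemidirectProduct.range_inl_eq_ker_rightHom]; infer_instance
  have hVc : ∀ x ∈ V, ∀ y ∈ V, x * y = y * x := by
    rintro _ ⟨n₁, rfl⟩ _ ⟨n₂, rfl⟩
    rw [← map_mul, ← map_mul, mul_comm]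
  have hV : IsPGroup q V :=
    (IsPGroup.of_card hcardN).of_surjective _ (SemidirectProduct.inl).rangeRestrict_surjective
  have hb : ψ (gens ⟨1, by omega⟩) ∈ V := h1 ▸ ⟨δ, rfl⟩
  have hκp : κ ^ p = 1 := by
    rw [← ofAdd_nsmul, nsmul_eq_mul, mul_one, ZMod.natCast_self, ofAdd_zero]
  have ha : ψ (gens ⟨0, by omega⟩) ^ p ∈ V := by
    rw [h0, ← map_pow, hκp, map_one]; exact V.one_mem
  have hab : ψ (gens ⟨0, by omega⟩) * ψ (gens ⟨1, by omega⟩) ≠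
      ψ (gens ⟨1, by omega⟩) * ψ (gens ⟨0, by omega⟩) := by
    rw [h0, h1]
    intro heq
    have hl := congrArg SemidirectProduct.left heq
    simp only [SemidirectProduct.mul_left, SemidirectProduct.left_inr, SemidirectProduct.left_inl,
      SemidirectProduct.right_inr, SemidirectProduct.right_inl, map_one, one_mul, mul_one] at hl
    have h0' := congrFun hl 0
    rw [hτ, show (0 : ZMod p) + κ.toAdd = 1 by simp [κ]] at h0'
    simp only [δ, Pi.mulSingle_eq_of_ne (one_ne_zero : (1 : ZMod p) ≠ 0),
      Pi.mulSingle_eq_same] at h0'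
    exact one_ne_zero (ofAdd_eq_one.mp h0'.symm)
  exact not_isMulTorsionFree_of_comm_pow ψ hψker V hVc hp hq hpq hV hb ha hab

/-- **Every OPEN subgroup `U` of a free pro-`Σ` group of rank `≥ 2` with two distinct primes in
`Σ` fails unique roots**: `U` is free pro-`Σ` of rank `(n − 1)[G : U] + 1 ≥ 2` (Schreier;
tree theorem `IsFreeProOn.exists_isFreeProOn_of_isOpen`).
[cite: MochizukiAbsTopI2012, Lemma 4.5 (i) p.54] -/
theorem not_isMulTorsionFree_of_isOpen_of_isFreeProOn (h : IsFreeProOn G S gens) (hn : 2 ≤ n)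
    {p q : ℕ} (hp : p.Prime) (hq : q.Prime) (hpq : p ≠ q) (hpS : p ∈ S) (hqS : q ∈ S)
    (U : Subgroup G) (hU : IsOpen (U : Set G)) : ¬ IsMulTorsionFree U := by
  obtain ⟨m, gens', hfree, hm⟩ := h.exists_isFreeProOn_of_isOpen (by omega) U hU
  haveI : Finite (G ⧸ U) := Subgroup.quotient_finite_of_isOpen U hU
  have h1 : 1 * 1 ≤ (n - 1) * U.index :=
    Nat.mul_le_mul (by omega) (Nat.one_le_iff_ne_zero.mpr Subgroup.index_ne_zero_of_finite)
  haveI : CompactSpace U := isCompact_iff_compactSpace.mp (U.isClosed_of_isOpen hU).isCompact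
  exact not_isMulTorsionFree_of_isFreeProOn_of_prime_ne hfree (by omega) hp hq hpq hpS hqS

/-- The PRO-OMISSIVE case `Σ = Primes ∖ {ℓ}` of [AbsTopI] Def. 1.1 (iii) (`IsAlmostProOmissive`):
a free pro-`Σ` group of rank `≥ 2` is NOT `IsMulTorsionFree` — for `ℓ ∈ {2, 3}` this is NOT
covered by the `S₃`-quotient argument. [cite: MochizukiAbsTopI2012, Def 1.1 (iii) p.10] -/
theorem not_isMulTorsionFree_of_isFreeProOn_proOmissive {ℓ : ℕ}
    (h : IsFreeProOn G {r | r.Prime ∧ r ≠ ℓ} gens) (hn : 2 ≤ n) : ¬ IsMulTorsionFree G := by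
  by_cases h2 : ℓ = 2
  · exact not_isMulTorsionFree_of_isFreeProOn_of_prime_ne h hn Nat.prime_three Nat.prime_five
      (by decide) ⟨Nat.prime_three, by omega⟩ ⟨Nat.prime_five, by omega⟩
  by_cases h3 : ℓ = 3
  · exact not_isMulTorsionFree_of_isFreeProOn_of_prime_ne h hn Nat.prime_two Nat.prime_five
      (by decide) ⟨Nat.prime_two, by omega⟩ ⟨Nat.prime_five, by omega⟩
  · exact not_isMulTorsionFree_of_isFreeProOn_of_prime_ne h hn Nat.prime_two Nat.prime_three
      (by decide) ⟨Nat.prime_two, fun h' => h2 h'.symm⟩ ⟨Nat.prime_three, fun h' => h3 h'.symm⟩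

end FreePro

/-- **If `J ∩ Δ_C` is free pro-`Σ` of rank `≥ 2` with two distinct primes in `Σ`, then
`J ∉ semiEllipticDoubleCoverSubgroups Π_C`** ([AbsTopII] Cor. 3.3 (ii) typed RHS, F-0234, which
types "`J ∩ Δ_C` is torsion-free" as `IsMulTorsionFree`): for EVERY `Σ` holding two primes the
typed RHS excludes the print LHS at free pro-`Σ` geometric fundamental groups of affine curves.
[cite: MochizukiAbsTopII2013, Cor 3.3 (ii) p.68] -/
theorem not_mem_semiEllipticDoubleCoverSubgroups_of_isFreeProOn_of_prime_ne
    (C : FundamentalExtension.{u}) (J : Subgroup C.arith) {S : Set ℕ} {n : ℕ}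
    {gens : Fin n → ↥(J ⊓ C.geom)} (hfree : IsFreeProOn ↥(J ⊓ C.geom) S gens) (hn : 2 ≤ n)
    {p q : ℕ} (hp : p.Prime) (hq : q.Prime) (hpq : p ≠ q) (hpS : p ∈ S) (hqS : q ∈ S) :
    J ∉ AbsTopII.semiEllipticDoubleCoverSubgroups C := by
  rintro ⟨hopen, -, htf⟩
  haveI := compactSpace_inf_geom C J hopen
  exact not_isMulTorsionFree_of_isFreeProOn_of_prime_ne hfree hn hp hq hpq hpS hqS htf

end Summit.ABC.IUTFork

end
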